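import Literature.NumberTheory.LFunctions.FresnelTail
import HarnessLib

/-!
# The Mellin transform of the tails `∫_X^∞ u^{-1/2} e^{-ru} du`, down to `Re r = 0`

Topic `Literature/NumberTheory/LFunctions`. Everything in this file is PROVED.

Second file of the Mellin computation behind Fawaz's `I(x)` (Anderson–Stark, LNM 899, §4
(16)–(19)); see `FresnelTail.lean` for the setting. For the damped tail
`Ψ_r(X) = ∫_X^∞ u^{-1/2} e^{-ru} du` (`Re r > 0`, `‖r‖ ≥ 1`) and `−1/2 < Re s < 0` we prove the
Mellin transform

  `∫_0^∞ Ψ_r(X) X^{-s-1} dX = −(1/s) (1/r)^{1/2−s} Γ(1/2 − s)`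
  (`integral_Ioi_tail_mul_cpow`)

by one integration by parts on `(0, ∞)` (`Ψ_r' = −X^{-1/2}e^{-rX}`, primitive `X^{-s}/(−s)` of
`X^{-s-1}`; the boundary terms vanish because `|Ψ_r(X)| ≤ 2X^{-1/2}` and `≤ √π + 2√X`) and the
tree's `∫_0^∞ u^{a−1}e^{-ru} du = (1/r)^a Γ(a)`. Letting `r = δ + r₀`, `δ → 0⁺` (`Re r₀ ≥ 0`,
`‖r₀‖ ≥ 1`, `Im r₀ ≠ 0`; dominated convergence with the majorant
`(√π+2)X^{-σ-1}` on `(0,1]`, `2X^{-3/2-σ}` on `(1,∞)`) gives the same formula for the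
integrated-by-parts boundary tails
`E_{r₀}(X) = e^{-r₀X}X^{-1/2}/r₀ − (1/(2r₀))∫_X^∞ u^{-3/2}e^{-r₀u} du` — at `r₀ = ∓i` these are the
Fresnel tails `∫_X^∞ u^{-1/2}e^{±iu} du`:

  `∫_0^∞ E_{r₀}(X) X^{-s-1} dX = −(1/s) (1/r₀)^{1/2−s} Γ(1/2 − s)`
  (`integral_Ioi_ibpTail_mul_cpow`, with integrability and the bounds
  `norm_ibpTail_le_two_mul_rpow`, `norm_ibpTail_le_sqrt_pi_add`).

## References

* [AndersonStark1981] R. J. Anderson, H. M. Stark, *Oscillation theorems*, LNM 899 (1981), §4,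
  (16)–(19) ("Fawaz simply applied the functional equation first … to get (17)").
* [Titchmarsh1986] E. C. Titchmarsh, *The Theory of the Riemann Zeta-Function*, §4.13 (the
  Γ-integrals, through the tree).
-/

noncomputable section

open Complex Filter MeasureTheory Set
open scoped Real Topology

namespace Literature.NumberTheory.LFunctions

/-! ## The majorant -/

/-- The majorant `G(X) = (√π+2) X^{-σ-1}` for `X ≤ 1`, `2 X^{-3/2-σ}` for `X > 1` is integrable on
`(0, ∞)` when `−1/2 < σ < 0`. [folklore] -/
theorem integrableOn_tailMajorant {σ : ℝ} (hs1 : -(1 / 2 : ℝ) < σ) (hs2 : σ < 0) :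
    IntegrableOn (fun X : ℝ ↦ if X ≤ 1 then (Real.sqrt π + 2) * X ^ (-σ - 1)
      else 2 * X ^ (-(3 / 2 : ℝ) - σ)) (Ioi 0) := by
  rw [← Ioc_union_Ioi_eq_Ioi zero_le_one]
  refine IntegrableOn.union ?_ ?_
  · have h : IntegrableOn (fun X : ℝ ↦ (Real.sqrt π + 2) * X ^ (-σ - 1)) (Ioc 0 1) := by
      rw [← intervalIntegrable_iff_integrableOn_Ioc_of_le zero_le_one]
      exact (intervalIntegral.intervalIntegrable_rpow' (by linarith)).const_mul _
    refine h.congr_fun (fun X hX ↦ ?_) measurableSet_Ioc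
    simp [hX.2]
  · have h : IntegrableOn (fun X : ℝ ↦ 2 * X ^ (-(3 / 2 : ℝ) - σ)) (Ioi 1) :=
      (integrableOn_Ioi_rpow_of_lt (by linarith) one_pos).const_mul _
    refine h.congr_fun (fun X hX ↦ ?_) measurableSet_Ioi
    have : ¬ X ≤ 1 := not_le.2 hX
    simp [this]

/-- The majorant dominates `B(X) X^{-σ-1}` whenever `‖B‖ ≤ 2X^{-1/2}` and `‖B‖ ≤ √π + 2√X`.
[folklore] -/
theorem norm_mul_cpow_le_tailMajorant {B : ℂ} {X : ℝ} (hX : 0 < X) {s : ℂ}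
    (h1 : ‖B‖ ≤ 2 * X ^ (-(1 / 2 : ℝ))) (h2 : ‖B‖ ≤ Real.sqrt π + 2 * Real.sqrt X) :
    ‖B * (X : ℂ) ^ (-s - 1)‖ ≤ if X ≤ 1 then (Real.sqrt π + 2) * X ^ (-s.re - 1)
      else 2 * X ^ (-(3 / 2 : ℝ) - s.re) := by
  rw [norm_mul, Complex.norm_cpow_eq_rpow_re_of_pos hX]
  have hre : (-s - 1).re = -s.re - 1 := by simp
  rw [hre]
  split_ifs with hX1
  · have hsq : Real.sqrt X ≤ 1 := Real.sqrt_le_one.mpr hX1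
    refine mul_le_mul_of_nonneg_right (h2.trans (by linarith)) (Real.rpow_nonneg hX.le _)
  · calc ‖B‖ * X ^ (-s.re - 1) ≤ 2 * X ^ (-(1 / 2 : ℝ)) * X ^ (-s.re - 1) :=
          mul_le_mul_of_nonneg_right h1 (Real.rpow_nonneg hX.le _)
      _ = 2 * X ^ (-(3 / 2 : ℝ) - s.re) := by
          rw [mul_assoc, ← Real.rpow_add hX]; congr 2; ring

/-- `‖r₀‖ ≤ ‖δ + r₀‖` for `δ ≥ 0`, `Re r₀ ≥ 0`. [folklore] -/
theorem norm_le_norm_ofReal_add {r₀ : ℂ} (hre : 0 ≤ r₀.re) {δ : ℝ} (hδ : 0 ≤ δ) :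
    ‖r₀‖ ≤ ‖(δ : ℂ) + r₀‖ := by
  have h : ‖r₀‖ ^ 2 ≤ ‖(δ : ℂ) + r₀‖ ^ 2 := by
    rw [Complex.sq_norm, Complex.sq_norm, Complex.normSq_apply, Complex.normSq_apply]
    simp only [Complex.add_re, Complex.ofReal_re, Complex.add_im, Complex.ofReal_im, zero_add]
    nlinarith
  exact (pow_le_pow_iff_left₀ (norm_nonneg _) (norm_nonneg _) two_ne_zero).1 h


/-! ## Derivative of a tail integral -/

/-- If `g` is integrable and continuous on `(c, ∞)` then `Y ↦ ∫_Y^∞ g` has derivative `−g(X)` at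
every `X > c`. [folklore] -/
theorem hasDerivAt_integral_Ioi {g : ℝ → ℂ} {c X : ℝ} (hcX : c < X) (hg : IntegrableOn g (Ioi c))
    (hcont : ContinuousOn g (Ioi c)) :
    HasDerivAt (fun Y ↦ ∫ u in Ioi Y, g u) (-g X) X := by
  have heq : ∀ Y ∈ Ioi c, ∫ u in Ioi Y, g u = (∫ u in Ioi c, g u) - ∫ u in c..Y, g u := by
    intro Y hY
    have hY : c < Y := hY
    rw [← Ioc_union_Ioi_eq_Ioi hY.le, setIntegral_union Ioc_disjoint_Ioi_same measurableSet_Ioi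
      (hg.mono_set Ioc_subset_Ioi_self) (hg.mono_set (Ioi_subset_Ioi hY.le)),
      intervalIntegral.integral_of_le hY.le]
    ring
  have hii : IntervalIntegrable g volume c X :=
    (intervalIntegrable_iff_integrableOn_Ioc_of_le hcX.le).2 (hg.mono_set Ioc_subset_Ioi_self)
  have h1 : HasDerivAt (fun Y ↦ ∫ u in c..Y, g u) (g X) X :=
    intervalIntegral.integral_hasDerivAt_right hii
      (hcont.stronglyMeasurableAtFilter isOpen_Ioi X hcX) (hcont.continuousAt (Ioi_mem_nhds hcX))
  have h2 : HasDerivAt (fun Y ↦ (∫ u in Ioi c, g u) - ∫ u in c..Y, g u) (0 - g X) X :=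
    (hasDerivAt_const X _).sub h1
  rw [zero_sub] at h2
  refine h2.congr_of_eventuallyEq ?_
  filter_upwards [Ioi_mem_nhds hcX] with Y hY using heq Y hY

/-! ## The Mellin transform of the damped tail -/

/-- **Mellin transform of the damped tail.** For `Re r > 0`, `‖r‖ ≥ 1` and `−1/2 < Re s < 0`:
`X ↦ (∫_X^∞ u^{-1/2}e^{-ru} du) X^{-s-1}` is integrable on `(0,∞)` and
`∫_0^∞ (∫_X^∞ u^{-1/2}e^{-ru} du) X^{-s-1} dX = −(1/s)(1/r)^{1/2−s} Γ(1/2−s)`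
(integration by parts on `(0,∞)` and `∫_0^∞ X^{-1/2-s} e^{-rX} dX = (1/r)^{1/2−s}Γ(1/2−s)`).
[cite: AndersonStark1981, §4 (16)–(19)] -/
theorem integral_Ioi_tail_mul_cpow {r : ℂ} (hr : 0 < r.re) (hr1 : 1 ≤ ‖r‖) {s : ℂ}
    (hs1 : -(1 / 2 : ℝ) < s.re) (hs2 : s.re < 0) :
    IntegrableOn (fun X : ℝ ↦ (∫ u in Ioi X, ((u ^ (-(1 / 2 : ℝ)) : ℝ) : ℂ) * cexp (-(r * u))) *
        (X : ℂ) ^ (-s - 1)) (Ioi 0) ∧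
      ∫ X in Ioi (0 : ℝ), (∫ u in Ioi X, ((u ^ (-(1 / 2 : ℝ)) : ℝ) : ℂ) * cexp (-(r * u))) *
          (X : ℂ) ^ (-s - 1) = -(1 / s) * (1 / r) ^ (1 / 2 - s) * Complex.Gamma (1 / 2 - s) := by
  have hs0 : s ≠ 0 := fun h ↦ by rw [h] at hs2; simp at hs2
  have hs0' : -s ≠ 0 := neg_ne_zero.2 hs0
  have hσ : 0 < -s.re := by linarith
  set f : ℝ → ℂ := fun u ↦ ((u ^ (-(1 / 2 : ℝ)) : ℝ) : ℂ) * cexp (-(r * u)) with hf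
  set Ψ : ℝ → ℂ := fun X ↦ ∫ u in Ioi X, f u with hΨ
  have hfint : IntegrableOn f (Ioi 0) := integrableOn_rpow_mul_cexp_Ioi_zero hr (by norm_num)
  have hfcont : ContinuousOn f (Ioi 0) := continuousOn_rpow_mul_cexp _ _
  -- the derivative of `Ψ`
  have hΨd : ∀ X ∈ Ioi (0 : ℝ), HasDerivAt Ψ (-f X) X := fun X hX ↦
    hasDerivAt_integral_Ioi hX hfint hfcont
  -- the primitive `v = X^{-s}/(-s)` of `X^{-s-1}`
  set v : ℝ → ℂ := fun X ↦ (X : ℂ) ^ (-s) / (-s) with hv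
  set v' : ℝ → ℂ := fun X ↦ (X : ℂ) ^ (-s - 1) with hv'
  have hvd : ∀ X ∈ Ioi (0 : ℝ), HasDerivAt v (v' X) X := by
    intro X hX
    have hX : 0 < X := hX
    have h := (AFE.hasDerivAt_ofReal_cpow hX (-s)).div_const (-s)
    simp only [hv, hv']
    refine h.congr_deriv ?_
    field_simp
  -- bounds on `Ψ`
  have hΨb1 : ∀ X : ℝ, 0 < X → ‖Ψ X‖ ≤ 2 * X ^ (-(1 / 2 : ℝ)) := fun X hX ↦
    norm_tail_le_two_mul_rpow hr hr1 hX
  have hΨb2 : ∀ X : ℝ, 0 < X → ‖Ψ X‖ ≤ Real.sqrt π + 2 * Real.sqrt X := fun X hX ↦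
    norm_tail_le_sqrt_pi_add hr hr1 hX
  -- norms of `v`, `v'`
  have hnv : ∀ X : ℝ, 0 < X → ‖v X‖ = X ^ (-s.re) / ‖s‖ := by
    intro X hX
    simp only [hv]
    rw [norm_div, norm_neg, Complex.norm_cpow_eq_rpow_re_of_pos hX]
    simp
  -- integrability of `Ψ * v'`
  have hΨcont : ContinuousOn Ψ (Ioi 0) := fun X hX ↦
    (hΨd X hX).continuousAt.continuousWithinAt
  have hv'cont : ContinuousOn v' (Ioi 0) := fun X hX ↦
    (Complex.continuousAt_ofReal_cpow_const X (-s - 1) (Or.inr (ne_of_gt hX))).continuousWithinAt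
  have hΨv' : IntegrableOn (Ψ * v') (Ioi 0) := by
    refine Integrable.mono' (integrableOn_tailMajorant hs1 hs2)
      ((hΨcont.mul hv'cont).aestronglyMeasurable measurableSet_Ioi) ?_
    refine (ae_restrict_iff' measurableSet_Ioi).2 (Eventually.of_forall fun X hX ↦ ?_)
    exact norm_mul_cpow_le_tailMajorant hX (hΨb1 X hX) (hΨb2 X hX)
  -- integrability of `(-f) * v = f X X^{-s} / s`
  have hfv_eq : ∀ X ∈ Ioi (0 : ℝ), (-f X) * v X =
      (1 / s) * ((X : ℂ) ^ ((1 / 2 - s) - 1) * cexp (-(r * X))) := by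
    intro X hX
    have hX : 0 < X := hX
    have hX0 : (X : ℂ) ≠ 0 := Complex.ofReal_ne_zero.2 hX.ne'
    simp only [hf, hv]
    rw [Complex.ofReal_cpow hX.le]
    have hpow : (X : ℂ) ^ (((-(1 / 2 : ℝ)) : ℝ) : ℂ) * (X : ℂ) ^ (-s) =
        (X : ℂ) ^ ((1 / 2 - s) - 1) := by
      rw [← Complex.cpow_add _ _ hX0]
      congr 1
      push_cast
      ring
    rw [← hpow]
    field_simp
  have hfv : IntegrableOn ((fun X ↦ -f X) * v) (Ioi 0) := by
    have ha : 0 < ((1 / 2 : ℂ) - s).re := by simp; linarith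
    have hbase : IntegrableOn (fun X : ℝ ↦ (X : ℂ) ^ ((1 / 2 - s) - 1) * cexp (-(r * X))) (Ioi 0) := by
      -- dominated by `exp(-(Re r) X) X^{-1/2-σ}`
      refine Integrable.mono' (AFE.integrableOn_exp_neg_mul_mul_rpow hr
        (by linarith : (-1 : ℝ) < -(1 / 2) - s.re)) ?_ ?_
      · refine ContinuousOn.aestronglyMeasurable (fun X hX ↦ ?_) measurableSet_Ioi
        exact ((Complex.continuousAt_ofReal_cpow_const X _ (Or.inr (ne_of_gt hX))).mul
          (by fun_prop)).continuousWithinAt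
      · refine (ae_restrict_iff' measurableSet_Ioi).2 (Eventually.of_forall fun X hX ↦ ?_)
        have hX : 0 < X := hX
        rw [norm_mul, Complex.norm_cpow_eq_rpow_re_of_pos hX, Complex.norm_exp]
        have h1 : ((1 / 2 : ℂ) - s - 1).re = -(1 / 2) - s.re := by simp; ring
        have h2 : (-(r * (X : ℂ))).re = -(r.re * X) := by simp
        rw [h1, h2, mul_comm]
    have h : IntegrableOn (fun X : ℝ ↦ (1 / s) * ((X : ℂ) ^ ((1 / 2 - s) - 1) * cexp (-(r * X))))
        (Ioi 0) := hbase.const_mul (1 / s)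
    refine h.congr_fun (fun X hX ↦ ?_) measurableSet_Ioi
    simp only [Pi.mul_apply]
    exact (hfv_eq X hX).symm
  -- boundary terms
  have h_infty : Tendsto (Ψ * v) atTop (𝓝 0) := by
    rw [tendsto_zero_iff_norm_tendsto_zero]
    have hlim : Tendsto (fun X : ℝ ↦ 2 / ‖s‖ * X ^ (-(1 / 2 + s.re))) atTop (𝓝 (2 / ‖s‖ * 0)) :=
      (tendsto_rpow_neg_atTop (by linarith : (0 : ℝ) < 1 / 2 + s.re)).const_mul _
    rw [mul_zero] at hlim
    refine squeeze_zero' (Eventually.of_forall fun X ↦ norm_nonneg _) ?_ hlim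
    filter_upwards [eventually_gt_atTop 0] with X hX
    rw [Pi.mul_apply, norm_mul, hnv X hX]
    calc ‖Ψ X‖ * (X ^ (-s.re) / ‖s‖) ≤ 2 * X ^ (-(1 / 2 : ℝ)) * (X ^ (-s.re) / ‖s‖) :=
          mul_le_mul_of_nonneg_right (hΨb1 X hX) (by positivity)
      _ = 2 / ‖s‖ * (X ^ (-(1 / 2 : ℝ)) * X ^ (-s.re)) := by ring
      _ = 2 / ‖s‖ * X ^ (-(1 / 2 + s.re)) := by
          rw [← Real.rpow_add hX]; congr 2; ring
  have h_zero : Tendsto (Ψ * v) (𝓝[>] 0) (𝓝 0) := by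
    rw [tendsto_zero_iff_norm_tendsto_zero]
    have hcont : ContinuousAt (fun X : ℝ ↦ X ^ (-s.re)) 0 :=
      Real.continuousAt_rpow_const 0 _ (Or.inr hσ.le)
    have hlim0 : Tendsto (fun X : ℝ ↦ (Real.sqrt π + 2) / ‖s‖ * X ^ (-s.re)) (𝓝[>] 0) (𝓝 0) := by
      have h := (hcont.tendsto.mono_left (nhdsWithin_le_nhds (s := Ioi (0 : ℝ)))).const_mul
        ((Real.sqrt π + 2) / ‖s‖)
      rwa [Real.zero_rpow hσ.ne', mul_zero] at h
    refine squeeze_zero' ?_ ?_ hlim0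
    · filter_upwards with X using norm_nonneg _
    · have hev : ∀ᶠ X in 𝓝[>] (0 : ℝ), X ∈ Ioo (0 : ℝ) 1 := Ioo_mem_nhdsGT one_pos
      filter_upwards [hev] with X hX
      rw [Pi.mul_apply, norm_mul, hnv X hX.1]
      have hsq : Real.sqrt X ≤ 1 := Real.sqrt_le_one.mpr hX.2.le
      have hΨle : ‖Ψ X‖ ≤ Real.sqrt π + 2 := (hΨb2 X hX.1).trans (by linarith)
      calc ‖Ψ X‖ * (X ^ (-s.re) / ‖s‖) ≤ (Real.sqrt π + 2) * (X ^ (-s.re) / ‖s‖) :=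
            mul_le_mul_of_nonneg_right hΨle
              (div_nonneg (Real.rpow_nonneg hX.1.le _) (norm_nonneg _))
        _ = (Real.sqrt π + 2) / ‖s‖ * X ^ (-s.re) := by ring
  -- integration by parts on `(0, ∞)`
  have hibp := integral_Ioi_mul_deriv_eq_deriv_mul hΨd hvd hΨv' hfv h_zero h_infty
  refine ⟨hΨv', ?_⟩
  have hlhs : (∫ X in Ioi (0 : ℝ), Ψ X * (X : ℂ) ^ (-s - 1)) = ∫ X in Ioi (0 : ℝ), Ψ X * v' X := rfl
  rw [hlhs, hibp, sub_self, zero_sub]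
  -- the remaining integral
  have ha : 0 < ((1 / 2 : ℂ) - s).re := by simp; linarith
  have hval : ∫ X in Ioi (0 : ℝ), (-f X) * v X =
      (1 / s) * ((1 / r) ^ (1 / 2 - s) * Complex.Gamma (1 / 2 - s)) := by
    rw [← AFE.integral_cpow_mul_exp_neg_mul_Ioi_complex ha hr, ← integral_const_mul]
    exact setIntegral_congr_fun measurableSet_Ioi hfv_eq
  rw [hval]
  ring

/-! ## Down to `Re r = 0` -/

section Boundary

variable {r₀ : ℂ}

/-- The two uniform bounds pass to the boundary tails `E_{r₀}(X)`: `‖E_{r₀}(X)‖ ≤ 2X^{-1/2}`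
(`Re r₀ ≥ 0`, `‖r₀‖ ≥ 1`, `X > 0`). At `r₀ = ∓i`: `|∫_X^∞ u^{-1/2}e^{±iu} du| ≤ 2X^{-1/2}`,
Anderson–Stark's "`|∫_y^∞ e^{iπv²/2} dv| ≤ 2/(πy)`" in the variable `u = πv²/2`.
[cite: AndersonStark1981, §4 (before (18))] -/
theorem norm_ibpTail_le_two_mul_rpow (hre : 0 ≤ r₀.re) (hnorm : 1 ≤ ‖r₀‖) {X : ℝ} (hX : 0 < X) :
    ‖cexp (-(r₀ * X)) * ((X ^ (-(1 / 2 : ℝ)) : ℝ) : ℂ) / r₀ -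
        1 / (2 * r₀) * ∫ u in Ioi X, ((u ^ (-(3 / 2 : ℝ)) : ℝ) : ℂ) * cexp (-(r₀ * u))‖ ≤
      2 * X ^ (-(1 / 2 : ℝ)) := by
  have hr0 : r₀ ≠ 0 := fun h ↦ by rw [h] at hnorm; norm_num at hnorm
  have hlim := (tendsto_ibpTail hre hr0 hX).norm
  refine le_of_tendsto hlim ?_
  filter_upwards [self_mem_nhdsWithin] with δ (hδ : 0 < δ)
  have hr : 0 < ((δ : ℂ) + r₀).re := by simp; linarith
  have hr1 : 1 ≤ ‖(δ : ℂ) + r₀‖ := hnorm.trans (norm_le_norm_ofReal_add hre hδ.le)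
  rw [← integral_Ioi_rpow_mul_cexp_eq_ibp hr hX]
  exact norm_tail_le_two_mul_rpow hr hr1 hX

/-- The boundary tails near zero: `‖E_{r₀}(X)‖ ≤ √π + 2√X` (`Re r₀ ≥ 0`, `‖r₀‖ ≥ 1`, `X > 0`).
[folklore] -/
theorem norm_ibpTail_le_sqrt_pi_add (hre : 0 ≤ r₀.re) (hnorm : 1 ≤ ‖r₀‖) {X : ℝ} (hX : 0 < X) :
    ‖cexp (-(r₀ * X)) * ((X ^ (-(1 / 2 : ℝ)) : ℝ) : ℂ) / r₀ -
        1 / (2 * r₀) * ∫ u in Ioi X, ((u ^ (-(3 / 2 : ℝ)) : ℝ) : ℂ) * cexp (-(r₀ * u))‖ ≤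
      Real.sqrt π + 2 * Real.sqrt X := by
  have hr0 : r₀ ≠ 0 := fun h ↦ by rw [h] at hnorm; norm_num at hnorm
  have hlim := (tendsto_ibpTail hre hr0 hX).norm
  refine le_of_tendsto hlim ?_
  filter_upwards [self_mem_nhdsWithin] with δ (hδ : 0 < δ)
  have hr : 0 < ((δ : ℂ) + r₀).re := by simp; linarith
  have hr1 : 1 ≤ ‖(δ : ℂ) + r₀‖ := hnorm.trans (norm_le_norm_ofReal_add hre hδ.le)
  rw [← integral_Ioi_rpow_mul_cexp_eq_ibp hr hX]
  exact norm_tail_le_sqrt_pi_add hr hr1 hX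


/-- The boundary tails are continuous on `(0, ∞)` (`Re r₀ ≥ 0`, `r₀ ≠ 0`). [folklore] -/
theorem continuousOn_ibpTail (hre : 0 ≤ r₀.re) :
    ContinuousOn (fun X : ℝ ↦ cexp (-(r₀ * X)) * ((X ^ (-(1 / 2 : ℝ)) : ℝ) : ℂ) / r₀ -
        1 / (2 * r₀) * ∫ u in Ioi X, ((u ^ (-(3 / 2 : ℝ)) : ℝ) : ℂ) * cexp (-(r₀ * u))) (Ioi 0) := by
  intro X hX
  have hX : 0 < X := hX
  have h1 : ContinuousAt (fun Y : ℝ ↦ cexp (-(r₀ * Y)) * ((Y ^ (-(1 / 2 : ℝ)) : ℝ) : ℂ) / r₀) X := by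
    refine (ContinuousAt.mul (by fun_prop) ?_).div_const _
    exact Complex.continuous_ofReal.continuousAt.comp
      (Real.continuousAt_rpow_const _ _ (Or.inl hX.ne'))
  have h2 : ContinuousAt (fun Y : ℝ ↦ ∫ u in Ioi Y, ((u ^ (-(3 / 2 : ℝ)) : ℝ) : ℂ) *
      cexp (-(r₀ * u))) X :=
    (hasDerivAt_integral_Ioi (by linarith : X / 2 < X)
      (integrableOn_rpow_mul_cexp_Ioi hre (by positivity) (by norm_num))
      ((continuousOn_rpow_mul_cexp _ _).mono (Ioi_subset_Ioi (by positivity)))).continuousAt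
  exact (h1.sub (continuousAt_const.mul h2)).continuousWithinAt

/-- **Mellin transform of the boundary tails.** For `Re r₀ ≥ 0`, `‖r₀‖ ≥ 1`, `Im r₀ ≠ 0` and
`−1/2 < Re s < 0`, the function `X ↦ E_{r₀}(X) X^{-s-1}` is integrable on `(0, ∞)` and
`∫_0^∞ E_{r₀}(X) X^{-s-1} dX = −(1/s)(1/r₀)^{1/2−s}Γ(1/2−s)`, where
`E_{r₀}(X) = e^{-r₀X}X^{-1/2}/r₀ − (1/(2r₀))∫_X^∞ u^{-3/2}e^{-r₀u} du` (`= ∫_X^∞ u^{-1/2}e^{-r₀u} du`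
when `Re r₀ > 0`, and the Fresnel tails at `r₀ = ∓i`). Proof: `r = δ + r₀`, `δ → 0⁺` in
`integral_Ioi_tail_mul_cpow` (dominated convergence; continuity of `z ↦ z^{1/2−s}` at
`1/r₀ ∉ (−∞, 0]`). [cite: AndersonStark1981, §4 (16)–(19)] -/
theorem integral_Ioi_ibpTail_mul_cpow (hre : 0 ≤ r₀.re) (hnorm : 1 ≤ ‖r₀‖) (him : r₀.im ≠ 0)
    {s : ℂ} (hs1 : -(1 / 2 : ℝ) < s.re) (hs2 : s.re < 0) :
    IntegrableOn (fun X : ℝ ↦ (cexp (-(r₀ * X)) * ((X ^ (-(1 / 2 : ℝ)) : ℝ) : ℂ) / r₀ -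
        1 / (2 * r₀) * ∫ u in Ioi X, ((u ^ (-(3 / 2 : ℝ)) : ℝ) : ℂ) * cexp (-(r₀ * u))) *
        (X : ℂ) ^ (-s - 1)) (Ioi 0) ∧
      ∫ X in Ioi (0 : ℝ), (cexp (-(r₀ * X)) * ((X ^ (-(1 / 2 : ℝ)) : ℝ) : ℂ) / r₀ -
          1 / (2 * r₀) * ∫ u in Ioi X, ((u ^ (-(3 / 2 : ℝ)) : ℝ) : ℂ) * cexp (-(r₀ * u))) *
          (X : ℂ) ^ (-s - 1) = -(1 / s) * (1 / r₀) ^ (1 / 2 - s) * Complex.Gamma (1 / 2 - s) := by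
  have hr0 : r₀ ≠ 0 := fun h ↦ by rw [h] at hnorm; norm_num at hnorm
  -- the boundary tails as a function of the parameter
  set E : ℂ → ℝ → ℂ := fun r X ↦ cexp (-(r * X)) * ((X ^ (-(1 / 2 : ℝ)) : ℝ) : ℂ) / r -
    1 / (2 * r) * ∫ u in Ioi X, ((u ^ (-(3 / 2 : ℝ)) : ℝ) : ℂ) * cexp (-(r * u)) with hE
  set G : ℝ → ℝ := fun X ↦ if X ≤ 1 then (Real.sqrt π + 2) * X ^ (-s.re - 1)
    else 2 * X ^ (-(3 / 2 : ℝ) - s.re) with hG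
  have hGint : IntegrableOn G (Ioi 0) := integrableOn_tailMajorant hs1 hs2
  have hv'cont : ContinuousOn (fun X : ℝ ↦ (X : ℂ) ^ (-s - 1)) (Ioi 0) := fun X hX ↦
    (Complex.continuousAt_ofReal_cpow_const X (-s - 1) (Or.inr (ne_of_gt hX))).continuousWithinAt
  -- measurability and domination, for every `r` with `Re r ≥ 0`, `‖r‖ ≥ 1`
  have hmeas : ∀ r : ℂ, 0 ≤ r.re → AEStronglyMeasurable (fun X ↦ E r X * (X : ℂ) ^ (-s - 1))
      (volume.restrict (Ioi 0)) := fun r hr ↦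
    ((continuousOn_ibpTail hr).mul hv'cont).aestronglyMeasurable measurableSet_Ioi
  have hdom : ∀ r : ℂ, 0 ≤ r.re → 1 ≤ ‖r‖ →
      ∀ᵐ X ∂(volume.restrict (Ioi 0)), ‖E r X * (X : ℂ) ^ (-s - 1)‖ ≤ G X := by
    intro r hr hr1
    refine (ae_restrict_iff' measurableSet_Ioi).2 (Eventually.of_forall fun X hX ↦ ?_)
    exact norm_mul_cpow_le_tailMajorant hX (norm_ibpTail_le_two_mul_rpow hr hr1 hX)
      (norm_ibpTail_le_sqrt_pi_add hr hr1 hX)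
  have hint : IntegrableOn (fun X ↦ E r₀ X * (X : ℂ) ^ (-s - 1)) (Ioi 0) :=
    Integrable.mono' hGint (hmeas r₀ hre) (hdom r₀ hre hnorm)
  refine ⟨hint, ?_⟩
  -- `δ > 0`: the hypotheses for `r = δ + r₀`
  have hreδ : ∀ δ : ℝ, 0 < δ → 0 < ((δ : ℂ) + r₀).re := fun δ hδ ↦ by simp; linarith
  have hnormδ : ∀ δ : ℝ, 0 < δ → 1 ≤ ‖(δ : ℂ) + r₀‖ := fun δ hδ ↦
    hnorm.trans (norm_le_norm_ofReal_add hre hδ.le)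
  -- dominated convergence on the left
  have hlimL : Tendsto (fun δ : ℝ ↦ ∫ X in Ioi (0 : ℝ), E (δ + r₀) X * (X : ℂ) ^ (-s - 1))
      (𝓝[>] 0) (𝓝 (∫ X in Ioi (0 : ℝ), E r₀ X * (X : ℂ) ^ (-s - 1))) := by
    refine tendsto_integral_filter_of_dominated_convergence G ?_ ?_ hGint ?_
    · filter_upwards [self_mem_nhdsWithin] with δ (hδ : 0 < δ)
      exact hmeas _ (hreδ δ hδ).le
    · filter_upwards [self_mem_nhdsWithin] with δ (hδ : 0 < δ)
      exact hdom _ (hreδ δ hδ).le (hnormδ δ hδ)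
    · refine (ae_restrict_iff' measurableSet_Ioi).2 (Eventually.of_forall fun X hX ↦ ?_)
      exact (tendsto_ibpTail hre hr0 hX).mul_const _
  -- the value for `δ > 0`
  have hval : ∀ δ : ℝ, 0 < δ → ∫ X in Ioi (0 : ℝ), E (δ + r₀) X * (X : ℂ) ^ (-s - 1) =
      -(1 / s) * (1 / ((δ : ℂ) + r₀)) ^ (1 / 2 - s) * Complex.Gamma (1 / 2 - s) := by
    intro δ hδ
    rw [← (integral_Ioi_tail_mul_cpow (hreδ δ hδ) (hnormδ δ hδ) hs1 hs2).2]
    refine setIntegral_congr_fun measurableSet_Ioi fun X hX ↦ ?_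
    simp only [hE]
    rw [integral_Ioi_rpow_mul_cexp_eq_ibp (hreδ δ hδ) hX]
  -- continuity on the right
  have hlimR : Tendsto (fun δ : ℝ ↦ -(1 / s) * (1 / ((δ : ℂ) + r₀)) ^ (1 / 2 - s) *
      Complex.Gamma (1 / 2 - s)) (𝓝[>] 0)
      (𝓝 (-(1 / s) * (1 / r₀) ^ (1 / 2 - s) * Complex.Gamma (1 / 2 - s))) := by
    have hδ : Tendsto (fun δ : ℝ ↦ (δ : ℂ) + r₀) (𝓝[>] 0) (𝓝 r₀) := by
      have : Tendsto (fun δ : ℝ ↦ (δ : ℂ) + r₀) (𝓝 0) (𝓝 ((0 : ℝ) + r₀)) :=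
        ((Complex.continuous_ofReal.add continuous_const).tendsto 0)
      rw [Complex.ofReal_zero, zero_add] at this
      exact this.mono_left nhdsWithin_le_nhds
    have hinv : Tendsto (fun δ : ℝ ↦ 1 / ((δ : ℂ) + r₀)) (𝓝[>] 0) (𝓝 (1 / r₀)) :=
      (continuousAt_const.div continuousAt_id hr0).tendsto.comp hδ
    have hslit : 1 / r₀ ∈ Complex.slitPlane := by
      rw [Complex.mem_slitPlane_iff]
      right
      rw [one_div, Complex.inv_im]
      exact div_ne_zero (neg_ne_zero.2 him) (Complex.normSq_pos.2 hr0).ne'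
    have hcpow := ((continuousAt_cpow_const (b := 1 / 2 - s) hslit).tendsto).comp hinv
    exact (hcpow.const_mul (-(1 / s))).mul_const _
  have hlimL' : Tendsto (fun δ : ℝ ↦ ∫ X in Ioi (0 : ℝ), E (δ + r₀) X * (X : ℂ) ^ (-s - 1))
      (𝓝[>] 0) (𝓝 (-(1 / s) * (1 / r₀) ^ (1 / 2 - s) * Complex.Gamma (1 / 2 - s))) := by
    refine hlimR.congr' ?_
    filter_upwards [self_mem_nhdsWithin] with δ (hδ : 0 < δ)
    exact (hval δ hδ).symm
  exact tendsto_nhds_unique hlimL hlimL'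

end Boundary

end Literature.NumberTheory.LFunctions
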